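import Summits.ValiantsHypothesis.ValiantsHypothesis.Theorems.LacunarySymmetroidMatrixDescartesDoorA26WallBubblingBubblingAssembly

/-!
# `DoorA26` line `wall_bubbling` — second-order engine, part 2: cluster limits WITH realisability at every stage, and the blow-up cluster

HONEST FRAMING.  Object-search cell `pub-symmetroid`; crux `Theses.LacunarySymmetroid.DoorA26` (stmt-ValiantsHypothesis-19979; OPEN,
typed, never asserted).  The bubbling chain (`…WallBubblingBubbling*`, obligation (B) of the line) packages an accumulation of twenties at
`δ⋆` as `ClusterLimit δ⋆`: normalised recentred Gram vectors `a c ν → H c ≠ 0` per zero cluster, with `Realisable (H c)`.  The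
SECOND-ORDER sieve at mixed walls / Weyl faces (obligations (M)/(W), slots W1/W2 of desk R2664) applies the rank-3 Schur identity at EVERY
stage `ν` (file `…WallBubblingSecondOrder`, `secondOrder_limit`), so it needs what `ClusterLimit` forgets: each `a c ν` is itself a
(positive multiple of a root-scale congruent) polar Gram matrix, hence `Realisable`.  This file re-derives the chain's construction with
that field kept, and isolates the blow-up cluster:

* `exists_clusterLimit_realisable` / `…_of_mem_closure` — `∃ D : ClusterLimit δ⋆, ∀ c ν, Realisable (of (D.a c ν))` (the proof is the
  chain's `clusterLimit_of_data` verbatim plus `realisable_recentred` at every `ν`);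
* `exists_blowup_cluster` — at a `δ⋆` with a pair-sum coincidence some cluster limit has ALL class sums zero (the chain's `count_absurd`
  dichotomy, stated positively), and `blockSumsZero_of_classSums` turns that into `BlockSumsZero δ⋆ (of (H c))`;
* `isSymm_of_realisable`, `tendsto_matrix_of_clusterLimit` — bookkeeping (symmetry of realisable matrices; entrywise convergence as
  matrix convergence) in the shape `secondOrder_limit` consumes.

NOT here: the chamber sign word along the subsequence and the second-level (ρ-)normalisation of the cross entries — successor pieces.
Nothing in this file bears on (W)/(M)/(R) themselves, on `DoorA26`, on `MatrixDescartes` (18050) or on `VP ≠ VNP`.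

[folklore] Bolzano–Weierstrass bookkeeping; the construction is the chain's (val-idea-15 g1 / val-port-4 g1), re-run with one extra field.
-/

-- `Summit.ValiantsHypothesis.ValiantsHypothesis.…` repeats a component by the D-0017 layout
-- (single-conjunct summit), which the `dupNamespace` linter flags; the name is mandated.
set_option linter.dupNamespace false

namespace Summit.ValiantsHypothesis.ValiantsHypothesis.Theorems.LacunarySymmetroidMatrixDescartes.WallBubbling.SecondOrder

open Finset Filter Topology
open Summit.ValiantsHypothesis.ValiantsHypothesis.Theorems.LacunarySymmetroidMatrixDescartes.WallBubbling.Bubbling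

/-- A realisable would-be Gram matrix is symmetric (the polar form is). [folklore] -/
theorem isSymm_of_realisable {G : Matrix (Fin 6) (Fin 6) ℝ} (hG : Realisable G) : G.IsSymm := by
  obtain ⟨ε, S, -, -, h⟩ := hG
  ext i j
  rw [Matrix.transpose_apply, h j i, h i j, polar_comm]

/-- Entrywise convergence of the cluster data, as convergence of `6 × 6` matrices. [folklore] -/
theorem tendsto_matrix_of_clusterLimit {δstar : Fin 6 → ℝ} (D : ClusterLimit δstar) (c : Fin D.C) :
    Tendsto (fun ν => Matrix.of fun k l => D.a c ν (k, l)) atTop (𝓝 (Matrix.of fun k l => D.H c (k, l))) :=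
  tendsto_pi_nhds.mpr fun k => tendsto_pi_nhds.mpr fun l => D.ha c (k, l)

/-- Class sums zero ⇒ block sums zero for the matrix of `H`. [this work] -/
theorem blockSumsZero_of_classSums (δ : Fin 6 → ℝ) (H : Pair → ℝ) (h : ∀ w, classSum H (pairExp δ) w = 0) :
    BlockSumsZero δ (Matrix.of fun k l => H (k, l)) := by
  intro v
  rw [blockSum_eq_classSum]
  exact h v

/-- **The blow-up cluster.**  At a `δ⋆` carrying a pair-sum coincidence, in any cluster-limit datum some cluster's limit has all its
`δ⋆`-class sums equal to zero (otherwise the chain's count `count_absurd` applies). [this work] -/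
theorem exists_blowup_cluster {δstar : Fin 6 → ℝ} (D : ClusterLimit δstar)
    (hcoin : ∃ i j k l : Fin 6, (i, j) ≠ (k, l) ∧ (i, j) ≠ (l, k) ∧ δstar i + δstar j = δstar k + δstar l) :
    ∃ c : Fin D.C, ∀ w, classSum (D.H c) (pairExp δstar) w = 0 := by
  by_contra h
  push Not at h
  exact count_absurd D hcoin h

/-- **Cluster limits with realisability at every stage** (the chain's S3c construction re-run, keeping the field it proves and forgets):
from twenties' data converging to `δ⋆` one extracts `D : ClusterLimit δ⋆` such that every normalised recentred Gram vector `D.a c ν` is,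
as a `6 × 6` matrix, `Realisable` (a positive multiple of the polar Gram matrix of root-scale congruent letters). [this work] -/
theorem exists_clusterLimit_realisable (δstar : Fin 6 → ℝ) (δseq : ℕ → Fin 6 → ℝ)
    (hδ : ∀ l, Tendsto (fun ν => δseq ν l) atTop (𝓝 (δstar l)))
    (S : ℕ → Fin 6 → Matrix (Fin 2) (Fin 2) ℝ) (hS : ∀ ν l, (S ν l).IsSymm)
    (hG0 : ∀ ν, (fun p : Pair => polar (S ν p.1) (S ν p.2)) ≠ 0)
    (z : ℕ → Fin 20 → ℝ) (hz : ∀ ν, StrictMono (z ν))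
    (hzero : ∀ ν j, expSum (fun p : Pair => polar (S ν p.1) (S ν p.2)) (pairExp (δseq ν)) (z ν j) = 0)
    (C : ℕ) (start : Fin C → Fin 20) (blk : Fin 20 → Fin C) (R : ℝ)
    (hwin : ∀ ν j, z ν j - z ν (start (blk j)) ∈ Set.Icc (-R) R)
    (hdrift : ∀ c c', c < c' → Tendsto (fun ν => z ν (start c') - z ν (start c)) atTop atTop) :
    ∃ D : ClusterLimit δstar, ∀ c ν, Realisable (Matrix.of fun k l => D.a c ν (k, l)) := by
  classical
  -- Gram vectors, centres, recentred vectors, norms, normalised vectors (verbatim from the chain)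
  let G : ℕ → Pair → ℝ := fun ν p => polar (S ν p.1) (S ν p.2)
  let s : Fin C → ℕ → ℝ := fun c ν => z ν (start c)
  let b : Fin C → ℕ → Pair → ℝ := fun c ν p => G ν p * Real.exp (pairExp (δseq ν) p * s c ν)
  have hb0 : ∀ c ν, b c ν ≠ 0 := by
    intro c ν hb
    apply hG0 ν
    funext p
    have := congrFun hb p
    simp only [b, Pi.zero_apply, mul_eq_zero, Real.exp_ne_zero, or_false] at this
    simpa [G] using this
  let N : Fin C → ℕ → ℝ := fun c ν => ‖b c ν‖
  have hNpos : ∀ c ν, 0 < N c ν := fun c ν => norm_pos_iff.mpr (hb0 c ν)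
  let a : Fin C → ℕ → Pair → ℝ := fun c ν p => (N c ν)⁻¹ * (G ν p * Real.exp (pairExp (δseq ν) p * s c ν))
  have ha_eq : ∀ c ν, a c ν = (N c ν)⁻¹ • b c ν := by
    intro c ν; funext p; simp only [a, b, Pi.smul_apply, smul_eq_mul]
  have hnorm_a : ∀ c ν, ‖a c ν‖ = 1 := by
    intro c ν
    rw [ha_eq, norm_smul, norm_inv, Real.norm_of_nonneg (norm_nonneg _)]
    exact inv_mul_cancel₀ (hNpos c ν).ne'
  have hbound : ∀ c ν p, |a c ν p| ≤ 1 := by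
    intro c ν p
    have := norm_le_pi_norm (a c ν) p
    rw [Real.norm_eq_abs, hnorm_a] at this
    exact this
  have hreal_a : ∀ c ν, Realisable (Matrix.of fun k l => a c ν (k, l)) := fun c ν =>
    realisable_recentred (δseq ν) (S ν) (hS ν) (N c ν)⁻¹ (s c ν)
  -- Bolzano–Weierstrass in `Fin C → Pair → ℝ`
  let A : ℕ → (Fin C → Pair → ℝ) := fun ν c => a c ν
  have hAball : ∀ ν, A ν ∈ Metric.closedBall (0 : Fin C → Pair → ℝ) 1 := by
    intro ν
    rw [Metric.mem_closedBall, dist_zero_right]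
    refine (pi_norm_le_iff_of_nonneg zero_le_one).mpr fun c => ?_
    exact (hnorm_a c ν).le
  obtain ⟨Hfull, -, ψ, hψ, hlim⟩ := tendsto_subseq_of_bounded Metric.isBounded_closedBall hAball
  have hlim_c : ∀ c, Tendsto (fun ν => a c (ψ ν)) atTop (𝓝 (Hfull c)) := fun c =>
    (tendsto_pi_nhds.mp hlim) c
  have hlim_cp : ∀ c p, Tendsto (fun ν => a c (ψ ν) p) atTop (𝓝 (Hfull c p)) := fun c p =>
    (tendsto_pi_nhds.mp (hlim_c c)) p
  have hHne : ∀ c, Hfull c ≠ 0 := by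
    intro c
    have h1 : Tendsto (fun ν => ‖a c (ψ ν)‖) atTop (𝓝 ‖Hfull c‖) := (hlim_c c).norm
    have h2 : Tendsto (fun ν => ‖a c (ψ ν)‖) atTop (𝓝 1) := by
      simp only [hnorm_a]; exact tendsto_const_nhds
    have : ‖Hfull c‖ = 1 := tendsto_nhds_unique h1 h2
    intro h0
    rw [h0, norm_zero] at this
    exact zero_ne_one this
  -- the structure, with the realisability of every stage as the extra output
  refine ⟨{
    C := C
    m := fun c => (Finset.univ.filter fun j : Fin 20 => blk j = c).card
    hm := ?_
    δseq := fun ν => δseq (ψ ν)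
    hδ := fun l => (hδ l).comp hψ.tendsto_atTop
    a := fun c ν => a c (ψ ν)
    H := Hfull
    ha := hlim_cp
    hbound := fun c ν p => hbound c (ψ ν) p
    hH := hHne
    hreal := ?_
    R := fun _ => R
    hzeros := ?_
    L := fun c c' ν => s c' (ψ ν) - s c (ψ ν)
    ρ := fun c c' ν => N c (ψ ν) / N c' (ψ ν)
    hρ := fun c c' ν => div_pos (hNpos c _) (hNpos c' _)
    hL := fun c c' hcc' => (hdrift c c' hcc').comp hψ.tendsto_atTop
    htransfer := ?_ }, fun c ν => hreal_a c (ψ ν)⟩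
  · -- ∑ m c = 20
    have := Finset.card_eq_sum_card_fiberwise (f := blk) (s := (Finset.univ : Finset (Fin 20)))
      (t := (Finset.univ : Finset (Fin C))) (fun _ _ => Finset.mem_univ _)
    rw [Finset.card_univ, Fintype.card_fin] at this
    exact this.symm
  · -- realisability of the limits (B11)
    intro c
    refine realisable_of_tendsto (Gseq := fun ν => Matrix.of fun k l => a c (ψ ν) (k, l)) ?_ ?_
    · intro ν
      exact hreal_a c (ψ ν)
    · exact tendsto_pi_nhds.mpr fun k => tendsto_pi_nhds.mpr fun l => hlim_cp c (k, l)
  · -- the zeros of cluster `c` in the window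
    intro c ν
    refine ⟨(Finset.univ.filter fun j : Fin 20 => blk j = c).image fun j => z (ψ ν) j - s c (ψ ν), ?_, ?_⟩
    · rw [Finset.card_image_of_injective]
      intro j j' h
      exact (hz (ψ ν)).injective (sub_left_injective h)
    · intro w hw
      obtain ⟨j, hj, rfl⟩ := Finset.mem_image.mp hw
      have hjc : blk j = c := (Finset.mem_filter.mp hj).2
      refine ⟨?_, ?_⟩
      · have := hwin (ψ ν) j
        rw [hjc] at this
        exact this
      · show expSum (a c (ψ ν)) (pairExp (δseq (ψ ν))) (z (ψ ν) j - s c (ψ ν)) = 0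
        rw [show a c (ψ ν) = fun p => (N c (ψ ν))⁻¹ * (G (ψ ν) p * Real.exp (pairExp (δseq (ψ ν)) p * s c (ψ ν)))
          from rfl, expSum_recenter, sub_add_cancel, hzero, mul_zero]
  · -- the transfer identity between clusters
    intro c c' _ ν p
    show a c' (ψ ν) p = a c (ψ ν) p * Real.exp (pairExp (δseq (ψ ν)) p * (s c' (ψ ν) - s c (ψ ν)))
      * (N c (ψ ν) / N c' (ψ ν))
    simp only [a]
    have hN := (hNpos c (ψ ν)).ne'
    have hN' := (hNpos c' (ψ ν)).ne'
    rw [mul_sub, Real.exp_sub]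
    field_simp

/-- **S3 with realisability at every stage.**  Every `δ⋆` in the closure of the twenty-locus carries cluster-limit data whose every
stage matrix is realisable. [this work] -/
theorem exists_clusterLimit_realisable_of_mem_closure (δstar : Fin 6 → ℝ) (hclos : δstar ∈ closure TwentyLocus) :
    ∃ D : ClusterLimit δstar, ∀ c ν, Realisable (Matrix.of fun k l => D.a c ν (k, l)) := by
  obtain ⟨δseq₀, hmem, hlim₀⟩ := mem_closure_iff_seq_limit.mp hclos
  choose S hS hG0 z hz hzero using fun ν => zeros_of_mem_twentyLocus (hmem ν)
  obtain ⟨φ, hφ, C, start, blk, R, -, -, hwin, hdrift⟩ := blocks z hz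
  have hδ : ∀ l, Tendsto (fun ν => δseq₀ (φ ν) l) atTop (𝓝 (δstar l)) := fun l =>
    ((tendsto_pi_nhds.mp hlim₀) l).comp hφ.tendsto_atTop
  exact exists_clusterLimit_realisable δstar (fun ν => δseq₀ (φ ν)) hδ (fun ν => S (φ ν)) (fun ν => hS (φ ν))
    (fun ν => hG0 (φ ν)) (fun ν => z (φ ν)) (fun ν => hz (φ ν)) (fun ν => hzero (φ ν)) C start blk R
    (fun ν j => hwin ν j) hdrift

/-- **Blow-up datum at a wall** (the second-order sieve's input, in one statement): at `δ⋆ ∈ closure TwentyLocus` with a pair-sum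
coincidence there are cluster data `D`, realisable at every stage, and a cluster `c` whose limit matrix `of (H c)` is non-zero,
realisable, has `BlockSumsZero δ⋆`, and is the entrywise limit of the realisable stage matrices `of (a c ν)`. [this work] -/
theorem blowup_datum (δstar : Fin 6 → ℝ) (hclos : δstar ∈ closure TwentyLocus)
    (hcoin : ∃ i j k l : Fin 6, (i, j) ≠ (k, l) ∧ (i, j) ≠ (l, k) ∧ δstar i + δstar j = δstar k + δstar l) :
    ∃ (D : ClusterLimit δstar) (c : Fin D.C),
      (∀ c' ν, Realisable (Matrix.of fun k l => D.a c' ν (k, l))) ∧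
      (Matrix.of fun k l => D.H c (k, l)) ≠ 0 ∧ Realisable (Matrix.of fun k l => D.H c (k, l)) ∧
      BlockSumsZero δstar (Matrix.of fun k l => D.H c (k, l)) ∧
      Tendsto (fun ν => Matrix.of fun k l => D.a c ν (k, l)) atTop (𝓝 (Matrix.of fun k l => D.H c (k, l))) := by
  obtain ⟨D, hDreal⟩ := exists_clusterLimit_realisable_of_mem_closure δstar hclos
  obtain ⟨c, hc⟩ := exists_blowup_cluster D hcoin
  refine ⟨D, c, hDreal, ?_, D.hreal c, blockSumsZero_of_classSums δstar (D.H c) hc, tendsto_matrix_of_clusterLimit D c⟩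
  intro hzero
  apply D.hH c
  funext p
  have := congrFun (congrFun hzero p.1) p.2
  simpa using this

end Summit.ValiantsHypothesis.ValiantsHypothesis.Theorems.LacunarySymmetroidMatrixDescartes.WallBubbling.SecondOrder
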